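import Summits.CriticalPhenomena.PercolationContinuityZ3.Theorems.PercNearOneGluingNoHeavyLowerTailAntitheticOSCount
import HarnessLib

/-!
# `NoHeavyLowerTail` (stmt-CriticalPhenomena-4575) — antithetic cluster pairs: THEOREM OS⁰ (one-sided augmentation with a marker AT THE SOURCE),
# the abstract BOUNDARY COUNT in the new case (prim-hp-2 gen 45; HOME/THEOREM-OS-augmentation.md §8)

Support file (`--supports stmt-CriticalPhenomena-4575`, hull-port prover `prim-hp-2`, gen 45).  No definitions, no named facts, no sorries.

PURE COMBINATORICS.  THEOREM OS⁰: on the cycle through `s`, `Σ_{T ∈ D(R′)} (F(C) − F(M ∪ ℓC′))(G(C) − G(M ∪ ℓC′)) ≥ 0` where `ℓ` attaches blue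
markers at marked vertices `≠ s` seen by `C′` and the marker set `M` sits AT `s` (always attached) — needed for ears whose hub is the source
(THEOREM E⁰).  Boundary terms: rr-arcs `(K_k, M)`, bb-arcs `(∅, M ∪ ℓK_k)`, the full terms `(E, M)`, `(∅, M ∪ ℓE)`, and at each position `i` the
one-change terms `rb_i = (P_i, M ∪ ℓQ_{n−i})`, `br_i = (Q_{n−i}, M ∪ ℓP_i)`.  For an upper-set pair `(U, W)` either `M` lies in both (no bad term),
in neither (then the count IS `OSCount.count` with the lifted thresholds), or — the NEW case treated here — `M ∈ U`, `M ∉ W`: then every blue-side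
set lies in `U`; with `W`-thresholds `b, d` (plain runs) and `1 ≤ b0 ≤ b`, `1 ≤ d0 ≤ d` (lifted runs `M ∪ ℓP_i`, `M ∪ ℓQ_j`) and `U`-thresholds
`a, c` (plain runs), the patterns are: `rb_i` BAD iff `¬ a ≤ i ∧ b ≤ i ∧ ¬ d0 ≤ n−i`, GOOD iff `¬ a ≤ i ∧ ¬ b ≤ i ∧ d0 ≤ n−i`; `br_i` BAD iff
`¬ c ≤ n−i ∧ d ≤ n−i ∧ ¬ b0 ≤ i`, GOOD iff `¬ c ≤ n−i ∧ ¬ d ≤ n−i ∧ b0 ≤ i`; the rr-arc `k` is BAD iff `K_k ∈ W ∖ U` and never good; the bb-arc `k`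
is GOOD iff `M ∪ ℓK_k ∈ W`.  The arcs may lie in `U`, `W` beyond what the runs force, so their memberships are FREE predicates `KU, KW, LW`
(and `EU, EW, LEW` for the full terms) subject only to the forcing implications.
* `Antithetic.OS0Count.count10` — #bad rr-arcs + [bad full] + #bad one-change terms on `I` ≤ #good bb-arcs + [good full] + #good one-change terms on `I`.
  Proof (THEOREM-OS §8): a bad rr-arc `k` has `K_k ∈ W`, hence `M ∪ ℓK_k ∈ W` (up-set): the bb-arc `k` is good (injection `k ↦ k`); after
  same-position cancellation the residual bad one-change positions form ONE interval (two exclusive cases), paid by SURPLUS arcs `k` (bb good by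
  forcing, rr not bad because `K_k ∈ U` is forced) and the full term.
Machine-checked before formalisation over all thresholds `n ≤ 7` and, with free arc memberships, `n ≤ 6` (HOME/code/gen45/lab/os0).
[cite: VandenbergHaggstromKahn2005, §1 p. 3 (open cluster `C_s`)]
-/

namespace Summit.CriticalPhenomena.PercolationContinuityZ3.Theorems

namespace Antithetic

namespace OS0Count

variable {n a c b d b0 d0 : ℕ} {KU KW LW : ℕ → Prop} {EU EW LEW : Prop}

/-- **THEOREM OS⁰, boundary count in the case `M ∈ U ∖ W`.** [this work] -/
theorem count10 [DecidablePred KU] [DecidablePred KW] [DecidablePred LW] [Decidable EU] [Decidable EW] [Decidable LEW] (I : Finset ℕ)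
    (ha : 1 ≤ a) (hc : 1 ≤ c) (hb0 : 1 ≤ b0) (hd0 : 1 ≤ d0) (hbb : b0 ≤ b) (hdd : d0 ≤ d)
    (hKU : ∀ k, (a ≤ k ∨ c ≤ n - 1 - k) → KU k) (hLW : ∀ k, KW k → LW k) (hLW' : ∀ k, (b0 ≤ k ∨ d0 ≤ n - 1 - k) → LW k)
    (hEU : (a < n ∨ c < n) → EU) (hLE : EW → LEW) (hLE' : (b0 < n ∨ d0 < n) → LEW) :
    ((Finset.Icc 1 (n - 2)).filter fun k => ¬ KU k ∧ KW k).card + (if ¬ EU ∧ EW then 1 else 0) +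
        (I.filter fun i => ¬ a ≤ i ∧ b ≤ i ∧ ¬ d0 ≤ n - i).card + (I.filter fun i => ¬ c ≤ n - i ∧ d ≤ n - i ∧ ¬ b0 ≤ i).card ≤
      ((Finset.Icc 1 (n - 2)).filter fun k => LW k).card + (if LEW then 1 else 0) +
        (I.filter fun i => ¬ a ≤ i ∧ ¬ b ≤ i ∧ d0 ≤ n - i).card + (I.filter fun i => ¬ c ≤ n - i ∧ ¬ d ≤ n - i ∧ b0 ≤ i).card := by
  -- arcs: bad rr-arcs and the SURPLUS arcs are disjoint subsets of the good bb-arcs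
  have arcs : ∀ lo hi : ℕ, (∀ k, lo ≤ k → k ≤ hi → (b0 ≤ k ∨ d0 ≤ n - 1 - k) ∧ (a ≤ k ∨ c ≤ n - 1 - k)) → 1 ≤ lo → hi ≤ n - 2 →
      ((Finset.Icc 1 (n - 2)).filter fun k => ¬ KU k ∧ KW k).card + (hi + 1 - lo) ≤
        ((Finset.Icc 1 (n - 2)).filter fun k => LW k).card := by
    intro lo hi hsur hlo hhi
    have hsub : ((Finset.Icc 1 (n - 2)).filter fun k => ¬ KU k ∧ KW k) ∪ Finset.Icc lo hi ⊆
        (Finset.Icc 1 (n - 2)).filter fun k => LW k := by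
      intro k hk
      rw [Finset.mem_union, Finset.mem_filter, Finset.mem_Icc, Finset.mem_Icc] at hk
      rw [Finset.mem_filter, Finset.mem_Icc]
      rcases hk with ⟨hk1, hk2⟩ | ⟨hk1, hk2⟩
      · exact ⟨hk1, hLW k hk2.2⟩
      · exact ⟨⟨le_trans hlo hk1, hk2.trans hhi⟩, hLW' k (hsur k hk1 hk2).1⟩
    have hdisj : Disjoint ((Finset.Icc 1 (n - 2)).filter fun k => ¬ KU k ∧ KW k) (Finset.Icc lo hi) := by
      rw [Finset.disjoint_left]
      intro k hk hk'
      rw [Finset.mem_filter] at hk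
      rw [Finset.mem_Icc] at hk'
      exact hk.2.1 (hKU k (hsur k hk'.1 hk'.2).2)
    have h := Finset.card_le_card hsub
    rw [Finset.card_union_of_disjoint hdisj, Nat.card_Icc] at h
    exact h
  -- the plain injection (no surplus needed)
  have arcs0 : ((Finset.Icc 1 (n - 2)).filter fun k => ¬ KU k ∧ KW k).card ≤ ((Finset.Icc 1 (n - 2)).filter fun k => LW k).card := by
    refine Finset.card_le_card fun k hk => ?_
    rw [Finset.mem_filter] at hk ⊢
    exact ⟨hk.1, hLW k hk.2.2⟩
  have full0 : (if ¬ EU ∧ EW then 1 else 0) ≤ (if LEW then 1 else 0) := by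
    split_ifs with h1 h2
    · exact le_rfl
    · exact absurd (hLE h1.2) h2
    · exact Nat.zero_le _
    · exact le_rfl
  by_cases hA : ∃ i, (¬ a ≤ i ∧ b ≤ i ∧ ¬ d0 ≤ n - i) ∧ c ≤ n - i
  · -- R1-type residue: every bad br position is a good rb position; bad rb positions with `¬ c ≤ n−i` are good br positions;
    -- the others lie in `[b, n−c]`, paid by the surplus arcs `[b, n−c−1]` and the full term
    obtain ⟨i₀, hi₀, hci₀⟩ := hA
    have s1 : (I.filter fun i => ¬ c ≤ n - i ∧ d ≤ n - i ∧ ¬ b0 ≤ i) ⊆ I.filter fun i => ¬ a ≤ i ∧ ¬ b ≤ i ∧ d0 ≤ n - i := by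
      intro k hk
      rw [Finset.mem_filter] at hk ⊢
      exact ⟨hk.1, by omega, by omega, by omega⟩
    have split : (I.filter fun i => ¬ a ≤ i ∧ b ≤ i ∧ ¬ d0 ≤ n - i) ⊆
        (I.filter fun i => ¬ c ≤ n - i ∧ ¬ d ≤ n - i ∧ b0 ≤ i) ∪ Finset.Icc b (n - c) := by
      intro k hk
      rw [Finset.mem_filter] at hk
      rw [Finset.mem_union, Finset.mem_filter, Finset.mem_Icc]
      by_cases hck : c ≤ n - k
      · exact Or.inr ⟨hk.2.2.1, by omega⟩
      · exact Or.inl ⟨hk.1, hck, by omega, by omega⟩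
    have c1 := Finset.card_le_card s1
    have c2 := (Finset.card_le_card split).trans (Finset.card_union_le _ _)
    rw [Nat.card_Icc] at c2
    have hfullE : EU := hEU (Or.inr (by omega))
    have hfullL : LEW := hLE' (Or.inl (by omega))
    rw [if_neg (fun h => h.1 hfullE), if_pos hfullL]
    by_cases hbn : b ≤ n - c - 1
    · have c3 := arcs b (n - c - 1) (fun k hk1 hk2 => ⟨Or.inl (hbb.trans hk1), Or.inr (by omega)⟩) (hb0.trans hbb) (by omega)
      omega
    · -- the residual interval is the single position `n − c`; the full term pays
      omega
  by_cases hB : ∃ i, (¬ c ≤ n - i ∧ d ≤ n - i ∧ ¬ b0 ≤ i) ∧ a ≤ i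
  · obtain ⟨i₀, hi₀, hai₀⟩ := hB
    have s1 : (I.filter fun i => ¬ a ≤ i ∧ b ≤ i ∧ ¬ d0 ≤ n - i) ⊆ I.filter fun i => ¬ c ≤ n - i ∧ ¬ d ≤ n - i ∧ b0 ≤ i := by
      intro k hk
      rw [Finset.mem_filter] at hk ⊢
      exact ⟨hk.1, by omega, by omega, by omega⟩
    have split : (I.filter fun i => ¬ c ≤ n - i ∧ d ≤ n - i ∧ ¬ b0 ≤ i) ⊆
        (I.filter fun i => ¬ a ≤ i ∧ ¬ b ≤ i ∧ d0 ≤ n - i) ∪ Finset.Icc a (n - d) := by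
      intro k hk
      rw [Finset.mem_filter] at hk
      rw [Finset.mem_union, Finset.mem_filter, Finset.mem_Icc]
      by_cases hak : a ≤ k
      · exact Or.inr ⟨hak, by omega⟩
      · exact Or.inl ⟨hk.1, hak, by omega, by omega⟩
    have c1 := Finset.card_le_card s1
    have c2 := (Finset.card_le_card split).trans (Finset.card_union_le _ _)
    rw [Nat.card_Icc] at c2
    have hfullE : EU := hEU (Or.inl (by omega))
    have hfullL : LEW := hLE' (Or.inr (by omega))
    rw [if_neg (fun h => h.1 hfullE), if_pos hfullL]
    by_cases han : a ≤ n - d0 - 1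
    · have c3 := arcs a (n - d0 - 1) (fun k hk1 hk2 => ⟨Or.inr (by omega), Or.inl hk1⟩) ha (by omega)
      omega
    · omega
  -- no residue: same-position cancellation only
  have s1 : (I.filter fun i => ¬ a ≤ i ∧ b ≤ i ∧ ¬ d0 ≤ n - i) ⊆ I.filter fun i => ¬ c ≤ n - i ∧ ¬ d ≤ n - i ∧ b0 ≤ i := by
    intro k hk
    rw [Finset.mem_filter] at hk ⊢
    exact ⟨hk.1, fun h => hA ⟨k, hk.2, h⟩, by omega, by omega⟩
  have s2 : (I.filter fun i => ¬ c ≤ n - i ∧ d ≤ n - i ∧ ¬ b0 ≤ i) ⊆ I.filter fun i => ¬ a ≤ i ∧ ¬ b ≤ i ∧ d0 ≤ n - i := by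
    intro k hk
    rw [Finset.mem_filter] at hk ⊢
    exact ⟨hk.1, fun h => hB ⟨k, hk.2, h⟩, by omega, by omega⟩
  have c1 := Finset.card_le_card s1
  have c2 := Finset.card_le_card s2
  omega

end OS0Count

end Antithetic

end Summit.CriticalPhenomena.PercolationContinuityZ3.Theorems
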